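import Literature.AlgebraicGeometry.Resolution.KnafKuhlmann2005Thm34Stability
import Literature.AlgebraicGeometry.Resolution.SubfieldTransport
import Summits.ResolutionOfSingularities.ResolutionOfSingularities.Theorems.FrobeniusClosingCampaignW41Core4Lemmas
import Mathlib.RingTheory.Finiteness.Nakayama
import Mathlib.Algebra.CharP.Lemmas
import Mathlib.Algebra.CharP.Algebra
import Mathlib.Algebra.Group.Torsion
import HarnessLib

/-!
# Crux `Steer` (stmt-16345), chain W4.1: the value group under density, and the `p`-divisible regime (C1, helper H1)

OURS (campaign `res-hironaka`, rung L, slot W4.1; replaces the role of no printed item; NOT a statement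
of the manuscript under review). Helper H1 of `CRUX-PLAN-Steer.md` §5 and its corollaries, which turn
four negative hypotheses of the registered Steer core `Sig.stub_steerDefectCore4` (line
`switching_dichotomy`: `¬ Discrete O`, `¬ DenseAbhyankar k O`, `¬ IsAbhyankarPlace O k ⊤`, and — via
`defect_of_pDivisible` of `FrobeniusClosingCampaignW41Core4Lemmas.lean` — `Defect O A₀ t p`) into
consequences of ONE valuation-side property of the certificate datum (the value group of `Frac A₀` is
`p`-divisible, e.g. `ℤ[1/p]`) and ONE algebraic property (`t ^ p` is not a `p`-th power in `Frac A₀`):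

* `valueGroup_fg_of_denseAbhyankar` (H1): if `k ⊆ O` and `K` is dense in a subfield `F₀ ⊇ k`,
  finitely generated over `k`, on which `O` is an Abhyankar place, then the value group of `O` is a
  finitely generated group (Temkin 2013, Rem. 2.1.3 for `F₀` = the tree's
  `valueGroup_fg_of_transcendenceDefect_eq_zero`, plus: density makes every value of `K` a value of `F₀`).
* `valuation_eq_one_of_fg_of_pDivisible`: a finitely generated value group all of whose elements are
  `p`-th powers (`2 ≤ p`) is trivial (Nakayama over `ℤ` + torsion-freeness of ordered groups).
* `not_denseAbhyankar_of_pDivisible`, `not_discrete_of_pDivisible`,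
  `denseAbhyankar_of_isAbhyankarPlace_top` (an Abhyankar place of a finitely generated `K/k` is
  trivially dense-Abhyankar with `F₀ = K`, so `¬ DenseAbhyankar` already implies `¬ IsAbhyankarPlace`).
* `pow_mem_of_mem_adjoin_insert`, `pDivisible_of_pDivisible_frac`: in characteristic `p`, with
  `t ^ p ∈ A₀` and `Frac (A₀[t]) = K`, every `p`-th power of an element of `K` is a fraction of `A₀`,
  so `p`-divisibility of the values of `Frac A₀` gives `p`-divisibility of the values of `K`.

Design: no `Theses.*` / `Cruxes.*` import (chain build rule); the skeleton's vocabulary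
(`DenseAbhyankar`, `Discrete`, `IsFracOf`) is INLINED verbatim in the statements (as in the landed
`switchingDefectlessSeq`), so the leaf consumes these lemmas by definitional unfolding.
Sources: M. Temkin, *Inseparable local uniformization*, J. Algebra 373 (2013), Rem. 2.1.3;
H. Knaf, F.-V. Kuhlmann, Ann. Sci. ENS 38 (2005), Thm. 2.1 (as proved in the tree); the rest is folklore.
-/

-- layout-mandated namespace `Summit.<Summit>.<Problem>.…` with Summit = Problem (single-conjunct summit)
set_option linter.dupNamespace false

namespace Summit.ResolutionOfSingularities.ResolutionOfSingularities.Theorems.SwitchingDichotomy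

open Literature.AlgebraicGeometry.Resolution

universe u v

/-! ## H1: density in a finitely generated Abhyankar subfield forces a finitely generated value group -/

/-- **H1 (Temkin 2013, Rem. 2.1.3, read through a dense subfield).** Let `O` be a valuation ring of
`K` containing (the image of) `k`. If there is a subfield `F₀` of `K` containing `k`, finitely
generated over `k`, on which `O` is an Abhyankar place, and in which `K` is dense (every `x ∈ K` is
approximable from `F₀` to within any non-zero value) — the skeleton's `DenseAbhyankar k O`, unfolded —
then the value group of `O` is finitely generated: by density every value of `K^×` is a value of
`F₀^×`, and the value group of the finitely generated Abhyankar `F₀/k` is finitely generated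
(`valueGroup_fg_of_transcendenceDefect_eq_zero`). [cite: Temkin2013, Remark 2.1.3] -/
theorem valueGroup_fg_of_denseAbhyankar {k : Type v} {K : Type u} [Field k] [Field K] [Algebra k K]
    (O : ValuationSubring K) (hk : ∀ c : k, algebraMap k K c ∈ O)
    (hd : ∃ F₀ : Subfield K, (algebraMap k K).fieldRange ≤ F₀ ∧
      FGOver (algebraMap k K).fieldRange F₀ ∧ IsAbhyankarPlace O (algebraMap k K).fieldRange F₀ ∧
      ∀ x w : K, w ≠ 0 → ∃ a ∈ F₀, O.valuation (x - a) < O.valuation w) :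
    Group.FG (ValuationSubring.ValueGroup O)ˣ := by
  classical
  obtain ⟨F₀, -, ⟨s₀, hs₀⟩, hA, hdense⟩ := hd
  set kr : Subfield K := (algebraMap k K).fieldRange with hkr
  have hkV : (kr : Set K) ⊆ O := by
    rintro _ ⟨c, rfl⟩
    exact hk c
  set M : IntermediateField kr K := IntermediateField.adjoin kr (s₀ : Set K) with hM
  have hMF : ∀ z : K, z ∈ M ↔ z ∈ F₀ := fun z => by
    rw [hM, mem_adjoin_subfield_iff, hs₀]
  have hfgM : (⊤ : IntermediateField kr M).FG :=
    IntermediateField.fg_top_iff.mpr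
      (IntermediateField.essFiniteType_iff.mpr (IntermediateField.fg_adjoin_finset s₀))
  set O' : ValuationSubring M := O.comap (algebraMap M K) with hO'
  have hk' : ∀ c : kr, algebraMap kr M c ∈ O' := algebraMap_mem_comap_intermediateField O M hkV
  have hD : transcendenceDefect kr O' hk' = 0 :=
    transcendenceDefect_comap_eq_zero_of_isAbhyankarPlace O M hMF hkV hfgM hA
  haveI hFG : Group.FG (ValuationSubring.ValueGroup O')ˣ :=
    valueGroup_fg_of_transcendenceDefect_eq_zero O' hfgM hk' hD
  -- transfer of values along `M → K`
  have htr : ∀ a b : M, O.valuation (a : K) = O.valuation (b : K) ↔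
      O'.valuation a = O'.valuation b := fun a b =>
    valuation_map_eq_iff (algebraMap M K) (V := O') (V' := O) rfl a b
  -- a representative of each unit of the value group of `O'`
  have hrep : ∀ γ : (ValuationSubring.ValueGroup O')ˣ, ∃ m : M, O'.valuation m = (γ : _) :=
    fun γ => O'.valuation_surjective _
  choose rep hrep using hrep
  have hrep0 : ∀ γ, (rep γ : K) ≠ 0 := fun γ h => by
    have h1 : rep γ = 0 := (map_eq_zero_iff _ (algebraMap M K).injective).mp h
    have h2 := hrep γ
    rw [h1, map_zero] at h2
    exact γ.ne_zero h2.symm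
  -- the transfer homomorphism
  have hone : O.valuation (rep 1 : K) = 1 := by
    have h := (htr (rep 1) 1).mpr (by rw [hrep, map_one, Units.val_one])
    rwa [OneMemClass.coe_one, map_one] at h
  have hmul : ∀ γ₁ γ₂, O.valuation (rep (γ₁ * γ₂) : K) =
      O.valuation (rep γ₁ : K) * O.valuation (rep γ₂ : K) := fun γ₁ γ₂ => by
    have h := (htr (rep (γ₁ * γ₂)) (rep γ₁ * rep γ₂)).mpr
      (by rw [hrep, map_mul, hrep, hrep, Units.val_mul])
    rwa [MulMemClass.coe_mul, map_mul] at h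
  let φ : (ValuationSubring.ValueGroup O')ˣ →* (ValuationSubring.ValueGroup O)ˣ :=
    { toFun := fun γ => Units.mk0 (O.valuation (rep γ : K))
        ((Valuation.ne_zero_iff _).mpr (hrep0 γ))
      map_one' := Units.ext (by rw [Units.val_mk0, Units.val_one, hone])
      map_mul' := fun γ₁ γ₂ => Units.ext (by
        rw [Units.val_mul, Units.val_mk0, Units.val_mk0, Units.val_mk0, hmul]) }
  have hφ : ∀ γ, ((φ γ : (ValuationSubring.ValueGroup O)ˣ) : ValuationSubring.ValueGroup O) =
      O.valuation (rep γ : K) := fun γ => rfl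
  refine Group.fg_of_surjective (f := φ) fun γ => ?_
  -- surjectivity: every value of `K^×` is the value of an element of `F₀` (density)
  obtain ⟨z, hz⟩ := O.valuation_surjective (γ : ValuationSubring.ValueGroup O)
  have hz0 : z ≠ 0 := fun h => by
    rw [h, map_zero] at hz
    exact γ.ne_zero hz.symm
  obtain ⟨a, haF, hlt⟩ := hdense z z hz0
  rw [Valuation.map_sub_swap] at hlt
  have hav : O.valuation a = O.valuation z := Valuation.map_eq_of_sub_lt _ hlt
  have ha0 : a ≠ 0 := fun h => by
    rw [h, map_zero] at hav
    exact hz0 ((Valuation.zero_iff _).mp hav.symm)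
  set m : M := ⟨a, (hMF a).mpr haF⟩ with hm
  have hm0 : m ≠ 0 := fun h => ha0 (congrArg Subtype.val h)
  refine ⟨Units.mk0 (O'.valuation m) ((Valuation.ne_zero_iff _).mpr hm0), Units.ext ?_⟩
  rw [hφ, ← hz, ← hav]
  refine (htr _ m).mpr ?_
  rw [hrep, Units.val_mk0]

/-! ## The `p`-divisible regime: a finitely generated `p`-divisible value group is trivial -/

/-- **A finitely generated value group all of whose elements are `p`-th powers is trivial** (`2 ≤ p`):
if the value group of `O` is finitely generated and every non-zero `z ∈ K` has the value of a `p`-th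
power, then `O` is the trivial valuation ring (`v z = 1` for all `z ≠ 0`). Proof: Nakayama over `ℤ`
gives `r ≡ 1 (mod p)` killing the (additively written) value group, and an ordered group is
torsion-free. [folklore] -/
theorem valuation_eq_one_of_fg_of_pDivisible {K : Type u} [Field K] (O : ValuationSubring K)
    [hG : Group.FG (ValuationSubring.ValueGroup O)ˣ] {p : ℕ} (hp : 2 ≤ p)
    (hdiv : ∀ z : K, z ≠ 0 → ∃ w : K, O.valuation z = O.valuation (w ^ p)) :
    ∀ z : K, z ≠ 0 → O.valuation z = 1 := by
  classical
  -- every unit of the value group is a `p`-th power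
  have hpow : ∀ γ : (ValuationSubring.ValueGroup O)ˣ, ∃ δ : (ValuationSubring.ValueGroup O)ˣ,
      γ = δ ^ p := by
    intro γ
    obtain ⟨z, hz⟩ := O.valuation_surjective (γ : ValuationSubring.ValueGroup O)
    have hz0 : z ≠ 0 := fun h => by
      rw [h, map_zero] at hz
      exact γ.ne_zero hz.symm
    obtain ⟨w, hw⟩ := hdiv z hz0
    have hw0 : w ≠ 0 := fun h => by
      rw [h, zero_pow (by omega), map_zero] at hw
      exact ((Valuation.ne_zero_iff _).mpr hz0) hw
    refine ⟨Units.mk0 (O.valuation w) ((Valuation.ne_zero_iff _).mpr hw0), Units.ext ?_⟩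
    rw [Units.val_pow_eq_pow_val, Units.val_mk0, ← map_pow, ← hw, hz]
  -- Nakayama over `ℤ` on the additively written value group
  haveI : Module.Finite ℤ (Additive (ValuationSubring.ValueGroup O)ˣ) :=
    Module.Finite.iff_addGroup_fg.mpr inferInstance
  have hle : (⊤ : Submodule ℤ (Additive (ValuationSubring.ValueGroup O)ˣ)) ≤
      (Ideal.span {(p : ℤ)}) • ⊤ := by
    intro m _
    obtain ⟨δ, hδ⟩ := hpow (Additive.toMul m)
    have hm : m = (p : ℤ) • Additive.ofMul δ := by
      apply Additive.toMul.injective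
      rw [hδ]
      simp
    rw [hm]
    exact Submodule.smul_mem_smul (Ideal.mem_span_singleton_self _) Submodule.mem_top
  obtain ⟨r, hr1, hr⟩ := Submodule.exists_sub_one_mem_and_smul_eq_zero_of_fg_of_le_smul
    (Ideal.span {(p : ℤ)}) ⊤ Module.Finite.fg_top hle
  have hr0 : r ≠ 0 := by
    rintro rfl
    rw [zero_sub, Ideal.mem_span_singleton, dvd_neg] at hr1
    have h1 : (p : ℤ) ≤ 1 := Int.le_of_dvd one_pos hr1
    omega
  -- every unit of the value group is trivial
  have htriv : ∀ γ : (ValuationSubring.ValueGroup O)ˣ, γ = 1 := by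
    intro γ
    have h := hr (Additive.ofMul γ) Submodule.mem_top
    have h' : γ ^ r = 1 := by
      have := congrArg Additive.toMul h
      simpa using this
    exact (IsMulTorsionFree.zpow_eq_one_iff_left hr0).mp h'
  intro z hz0
  have h := congrArg Units.val (htriv (Units.mk0 (O.valuation z) ((Valuation.ne_zero_iff _).mpr hz0)))
  rwa [Units.val_mk0, Units.val_one] at h

/-- **`¬ DenseAbhyankar` in the `p`-divisible regime.** If `k ⊆ O`, `O` is non-trivial on `K`
(some `z ≠ 0` has value `≠ 1`), `2 ≤ p`, and every non-zero element of `K` has the value of a `p`-th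
power, then `K` is NOT dense in any finitely generated subfield `F₀ ⊇ k` on which `O` is an Abhyankar
place — the negation of the skeleton's `DenseAbhyankar k O`, unfolded (H1 + the previous lemma).
[folklore] -/
theorem not_denseAbhyankar_of_pDivisible {k : Type v} {K : Type u} [Field k] [Field K]
    [Algebra k K] (O : ValuationSubring K) (hk : ∀ c : k, algebraMap k K c ∈ O)
    (hnt : ∃ z : K, z ≠ 0 ∧ O.valuation z ≠ 1) {p : ℕ} (hp : 2 ≤ p)
    (hdiv : ∀ z : K, z ≠ 0 → ∃ w : K, O.valuation z = O.valuation (w ^ p)) :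
    ¬ ∃ F₀ : Subfield K, (algebraMap k K).fieldRange ≤ F₀ ∧
      FGOver (algebraMap k K).fieldRange F₀ ∧ IsAbhyankarPlace O (algebraMap k K).fieldRange F₀ ∧
      ∀ x w : K, w ≠ 0 → ∃ a ∈ F₀, O.valuation (x - a) < O.valuation w := by
  intro hd
  haveI := valueGroup_fg_of_denseAbhyankar O hk hd
  obtain ⟨z, hz0, hz1⟩ := hnt
  exact hz1 (valuation_eq_one_of_fg_of_pDivisible O hp hdiv z hz0)

/-- **`¬ Discrete` in the `p`-divisible regime.** If `2 ≤ p` and every non-zero element of `K` has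
the value of a `p`-th power, then `O` is not discrete of rank one — the negation of the skeleton's
`Discrete O`, unfolded: a uniformizer `π` would have `v π = (v π) ^ (n p)` for some `n : ℤ`, and an
ordered group is torsion-free. [folklore] -/
theorem not_discrete_of_pDivisible {K : Type u} [Field K] (O : ValuationSubring K) {p : ℕ}
    (hp : 2 ≤ p) (hdiv : ∀ z : K, z ≠ 0 → ∃ w : K, O.valuation z = O.valuation (w ^ p)) :
    ¬ ∃ π : K, π ≠ 0 ∧ O.valuation π < 1 ∧
      ∀ z : K, z ≠ 0 → ∃ n : ℤ, O.valuation z = O.valuation π ^ n := by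
  rintro ⟨π, hπ0, hπ1, hcyc⟩
  obtain ⟨w, hw⟩ := hdiv π hπ0
  have hw0 : w ≠ 0 := fun h => by
    rw [h, zero_pow (by omega), map_zero] at hw
    exact ((Valuation.ne_zero_iff _).mpr hπ0) hw
  obtain ⟨n, hn⟩ := hcyc w hw0
  set u : (ValuationSubring.ValueGroup O)ˣ :=
    Units.mk0 (O.valuation π) ((Valuation.ne_zero_iff _).mpr hπ0) with hu
  set uw : (ValuationSubring.ValueGroup O)ˣ :=
    Units.mk0 (O.valuation w) ((Valuation.ne_zero_iff _).mpr hw0) with huw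
  have hu1 : u ≠ 1 := fun h => by
    have h' := congrArg Units.val h
    rw [hu, Units.val_mk0, Units.val_one] at h'
    exact hπ1.ne h'
  have hw' : u = uw ^ p := Units.ext (by
    rw [Units.val_pow_eq_pow_val, hu, huw, Units.val_mk0, Units.val_mk0, ← map_pow, hw])
  have hn' : uw = u ^ n := Units.ext (by
    rw [Units.val_zpow_eq_zpow_val, hu, huw, Units.val_mk0, Units.val_mk0, hn])
  -- `u = u ^ (n * p)`, so `u ^ (n * p - 1) = 1`
  have hpow : u ^ (n * p) = u := by
    rw [zpow_mul, zpow_natCast, ← hn', ← hw']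
  have hpow' : u ^ (n * p - 1) = 1 := by
    rw [zpow_sub_one, hpow, mul_inv_cancel]
  have hnp : n * p - 1 = 0 := by
    by_contra h
    exact hu1 ((IsMulTorsionFree.zpow_eq_one_iff_left h).mp hpow')
  have hdvd : (p : ℤ) ∣ 1 := ⟨n, by linarith⟩
  have h1 : (p : ℤ) ≤ 1 := Int.le_of_dvd one_pos hdvd
  omega

/-- **An Abhyankar place of a finitely generated `K/k` is dense-Abhyankar** (with `F₀ = K`: every
element approximates itself). Hence, for the registered Steer core, `¬ DenseAbhyankar k O` already
implies `¬ IsAbhyankarPlace O k K` once `K/k` is finitely generated. [folklore] -/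
theorem denseAbhyankar_of_isAbhyankarPlace_top {k : Type v} {K : Type u} [Field k] [Field K]
    [Algebra k K] (O : ValuationSubring K) (hfg : FGOver (algebraMap k K).fieldRange ⊤)
    (hA : IsAbhyankarPlace O (algebraMap k K).fieldRange ⊤) :
    ∃ F₀ : Subfield K, (algebraMap k K).fieldRange ≤ F₀ ∧
      FGOver (algebraMap k K).fieldRange F₀ ∧ IsAbhyankarPlace O (algebraMap k K).fieldRange F₀ ∧
      ∀ x w : K, w ≠ 0 → ∃ a ∈ F₀, O.valuation (x - a) < O.valuation w := by
  refine ⟨⊤, le_top, hfg, hA, fun x w hw => ⟨x, Subfield.mem_top x, ?_⟩⟩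
  rw [sub_self, map_zero]
  exact zero_lt_iff.mpr ((Valuation.ne_zero_iff _).mpr hw)

/-- `¬ DenseAbhyankar k O` implies `¬ IsAbhyankarPlace O k K` for `K/k` finitely generated
(contrapositive of `denseAbhyankar_of_isAbhyankarPlace_top`). [folklore] -/
theorem not_isAbhyankarPlace_top_of_not_denseAbhyankar {k : Type v} {K : Type u} [Field k]
    [Field K] [Algebra k K] (O : ValuationSubring K) (hfg : FGOver (algebraMap k K).fieldRange ⊤)
    (hnd : ¬ ∃ F₀ : Subfield K, (algebraMap k K).fieldRange ≤ F₀ ∧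
      FGOver (algebraMap k K).fieldRange F₀ ∧ IsAbhyankarPlace O (algebraMap k K).fieldRange F₀ ∧
      ∀ x w : K, w ≠ 0 → ∃ a ∈ F₀, O.valuation (x - a) < O.valuation w) :
    ¬ IsAbhyankarPlace O (algebraMap k K).fieldRange ⊤ :=
  fun hA => hnd (denseAbhyankar_of_isAbhyankarPlace_top O hfg hA)

/-! ## Characteristic `p`: `K ^ p ⊆ Frac A₀` for `K = Frac (A₀[t])`, `t ^ p ∈ A₀` -/

/-- In characteristic `p`, if `t ^ p ∈ A₀` then the `p`-th power of every element of `A₀[t]` lies in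
`A₀` (Frobenius is additive). [folklore] -/
theorem pow_mem_of_mem_adjoin_insert {k : Type v} {K : Type u} [Field k] [Field K] [Algebra k K]
    (p : ℕ) [Fact p.Prime] [CharP K p] (A₀ : Subalgebra k K) (t : K) (htp : t ^ p ∈ A₀) {x : K}
    (hx : x ∈ Algebra.adjoin k (insert t (A₀ : Set K))) : x ^ p ∈ A₀ := by
  induction hx using Algebra.adjoin_induction with
  | mem x hx =>
    rcases Set.mem_insert_iff.mp hx with rfl | hx
    · exact htp
    · exact A₀.pow_mem hx p
  | algebraMap c =>
    rw [← map_pow]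
    exact A₀.algebraMap_mem _
  | add x y _ _ hx hy =>
    rw [add_pow_char]
    exact A₀.add_mem hx hy
  | mul x y _ _ hx hy =>
    rw [mul_pow]
    exact A₀.mul_mem hx hy

/-- In characteristic `p`, with `t ^ p ∈ A₀` and `Frac (A₀[t]) = K`: the `p`-th power of every
element of `K` is a fraction `y / s` of elements of `A₀` (the skeleton's `IsFracOf A₀ (z ^ p)`,
unfolded). [folklore] -/
theorem isFracOf_pow_of_isFractionRing {k : Type v} {K : Type u} [Field k] [Field K] [Algebra k K]
    (p : ℕ) [Fact p.Prime] [CharP K p] (A₀ : Subalgebra k K) (t : K) (htp : t ^ p ∈ A₀)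
    (hfr : IsFractionRing (Algebra.adjoin k (insert t (A₀ : Set K))) K) (z : K) :
    ∃ y ∈ A₀, ∃ s ∈ A₀, s ≠ 0 ∧ z ^ p = y / s := by
  haveI := hfr
  obtain ⟨a, b, hb, hab⟩ := IsFractionRing.div_surjective (A := Algebra.adjoin k (insert t (A₀ : Set K))) z
  have hb0 : (b : K) ≠ 0 := fun h =>
    nonZeroDivisors.ne_zero hb (Subtype.ext h)
  refine ⟨(a : K) ^ p, pow_mem_of_mem_adjoin_insert p A₀ t htp a.2, (b : K) ^ p,
    pow_mem_of_mem_adjoin_insert p A₀ t htp b.2, pow_ne_zero _ hb0, ?_⟩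
  rw [← hab, div_pow]
  rfl

/-- **Values of `K` from values of `Frac A₀`.** If the `p`-th power of every element of `K` is a
fraction of `A₀` (`p ≠ 0`) and every non-zero fraction of `A₀` has the value of a `p`-th power of a
fraction of `A₀`, then every non-zero element of `K` has the value of a `p`-th power of a fraction of
`A₀` (so the value groups of `K` and `Frac A₀` coincide and are `p`-divisible). [folklore] -/
theorem pDivisible_of_pDivisible_frac {k : Type v} {K : Type u} [Field k] [Field K] [Algebra k K]
    (O : ValuationSubring K) (A₀ : Subalgebra k K) {p : ℕ} (hp : p ≠ 0)
    (hK : ∀ z : K, ∃ y ∈ A₀, ∃ s ∈ A₀, s ≠ 0 ∧ z ^ p = y / s)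
    (hdivF : ∀ x : K, (∃ y ∈ A₀, ∃ s ∈ A₀, s ≠ 0 ∧ x = y / s) → x ≠ 0 →
      ∃ w : K, (∃ y ∈ A₀, ∃ s ∈ A₀, s ≠ 0 ∧ w = y / s) ∧ O.valuation x = O.valuation (w ^ p)) :
    ∀ z : K, z ≠ 0 →
      ∃ w : K, (∃ y ∈ A₀, ∃ s ∈ A₀, s ≠ 0 ∧ w = y / s) ∧ O.valuation z = O.valuation (w ^ p) := by
  intro z hz0
  obtain ⟨w₁, hw₁, hv₁⟩ := hdivF (z ^ p) (hK z) (pow_ne_zero _ hz0)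
  rw [map_pow, map_pow] at hv₁
  have hzw : O.valuation z = O.valuation w₁ := pow_left_injective hp hv₁
  have hw₁0 : w₁ ≠ 0 := fun h => by
    rw [h, map_zero] at hzw
    exact ((Valuation.ne_zero_iff _).mpr hz0) hzw
  obtain ⟨w, hw, hv⟩ := hdivF w₁ hw₁ hw₁0
  exact ⟨w, hw, hzw.trans hv⟩

/-! ## Summary for the certificate datum: four hypotheses of `Sig.stub_steerDefectCore4` at once -/

/-- **The `p`-divisible regime of the Steer core (chain W4.1, C1 certificate, Lean half).** In the
setting of the registered stub `stub_steerDefectCore4` (`k` of characteristic `p`, `A₀ ⊆ O` a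
`k`-subalgebra of `K`, `t ^ p ∈ A₀`, `Frac (A₀[t]) = K`, `K/k` finitely generated as a field), assume
(i) every non-zero fraction of `A₀` has the value of a `p`-th power of a fraction of `A₀` (the value
group of `Frac A₀` is `p`-divisible — e.g. `ℤ[1/p]`), (ii) `t ^ p` is not the `p`-th power of a
fraction of `A₀`, (iii) `O` is non-trivial on `K`. Then FOUR hypotheses of the stub hold for this datum:
`¬ Discrete O`, `¬ DenseAbhyankar k O`, `¬ IsAbhyankarPlace O k K`, and `Defect O A₀ t p` (hence
`¬ (StronglySwitching ∧ ArchSeq ∧ ¬ Defect)`), all in the skeleton's vocabulary unfolded verbatim.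
OURS; replaces the role of no printed item. [folklore] -/
theorem core4Negatives_of_pDivisible (p : ℕ) (hp : p.Prime) {k : Type v} {K : Type u} [Field k]
    [CharP k p] [Field K] [Algebra k K] (O : ValuationSubring K) (A₀ : Subalgebra k K)
    (h₀ : A₀.toSubring ≤ O.toSubring) (t : K) (htp : t ^ p ∈ A₀)
    (hfr : IsFractionRing (Algebra.adjoin k (insert t (A₀ : Set K))) K)
    (hfgK : FGOver (algebraMap k K).fieldRange ⊤)
    (hdivF : ∀ x : K, (∃ y ∈ A₀, ∃ s ∈ A₀, s ≠ 0 ∧ x = y / s) → x ≠ 0 →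
      ∃ w : K, (∃ y ∈ A₀, ∃ s ∈ A₀, s ≠ 0 ∧ w = y / s) ∧ O.valuation x = O.valuation (w ^ p))
    (hnp : ∀ g : K, (∃ y ∈ A₀, ∃ s ∈ A₀, s ≠ 0 ∧ g = y / s) → t ^ p ≠ g ^ p)
    (hnt : ∃ z : K, z ≠ 0 ∧ O.valuation z ≠ 1) :
    (¬ ∃ π : K, π ≠ 0 ∧ O.valuation π < 1 ∧
        ∀ z : K, z ≠ 0 → ∃ n : ℤ, O.valuation z = O.valuation π ^ n) ∧
    (¬ ∃ F₀ : Subfield K, (algebraMap k K).fieldRange ≤ F₀ ∧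
        FGOver (algebraMap k K).fieldRange F₀ ∧ IsAbhyankarPlace O (algebraMap k K).fieldRange F₀ ∧
        ∀ x w : K, w ≠ 0 → ∃ a ∈ F₀, O.valuation (x - a) < O.valuation w) ∧
    ¬ IsAbhyankarPlace O (algebraMap k K).fieldRange ⊤ ∧
    (∀ g : K, (∃ y ∈ A₀, ∃ s ∈ A₀, s ≠ 0 ∧ g = y / s) →
      ∃ w : K, (∃ y ∈ A₀, ∃ s ∈ A₀, s ≠ 0 ∧ w = y / s) ∧
        O.valuation (t ^ p - g ^ p) = O.valuation (w ^ p)) := by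
  haveI : Fact p.Prime := ⟨hp⟩
  haveI : CharP K p := charP_of_injective_algebraMap (algebraMap k K).injective p
  have hk : ∀ c : k, algebraMap k K c ∈ O := fun c => h₀ (A₀.algebraMap_mem c)
  have hK : ∀ z : K, ∃ y ∈ A₀, ∃ s ∈ A₀, s ≠ 0 ∧ z ^ p = y / s :=
    isFracOf_pow_of_isFractionRing p A₀ t htp hfr
  have hdiv' := pDivisible_of_pDivisible_frac O A₀ hp.ne_zero hK hdivF
  have hdiv : ∀ z : K, z ≠ 0 → ∃ w : K, O.valuation z = O.valuation (w ^ p) := fun z hz => by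
    obtain ⟨w, -, hw⟩ := hdiv' z hz
    exact ⟨w, hw⟩
  have hnd := not_denseAbhyankar_of_pDivisible O hk hnt hp.two_le hdiv
  exact ⟨not_discrete_of_pDivisible O hp.two_le hdiv, hnd,
    not_isAbhyankarPlace_top_of_not_denseAbhyankar O hfgK hnd,
    defect_of_pDivisible O A₀ t p htp hdivF hnp⟩

end Summit.ResolutionOfSingularities.ResolutionOfSingularities.Theorems.SwitchingDichotomy
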